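import Literature.NumberTheory.ComplexMultiplication.FiniteQAlgebraLatticePicardExtensionSurjective
import Literature.NumberTheory.ComplexMultiplication.FiniteQAlgebraLatticeConductorKernelBijection
import HarnessLib

/-!
# THE CLASS NUMBER FORMULA OF A PAIR OF ORDERS `Λ_2 ⊆ Λ_1` OF AN ARBITRARY FINITE-DIMENSIONAL COMMUTATIVE
# `ℚ`-ALGEBRA: `|G([Λ_2]_ε)| · |(Λ_2/C)^{unit}| · [Λ_1^{unit} : Λ_2^{unit}] = |G([Λ_1]_ε)| · |(Λ_1/C)^{unit}|`,
# `C = Λ_2:Λ_1` the conductor (Hertling–Larabi 2026 Thm. 8.2 (c)–(f) (8.10) ∕ 2026b Thm. 5.12 (c)–(e) (5.22);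
# Dedekind ∕ Neukirch I (12.12) for one number field) — by counting the kernel of `G(Λ_2) → G(Λ_1)` twice

[topic NumberTheory/ComplexMultiplication] General-`A` series (namespace
`Literature.NumberTheory.ComplexMultiplication.FiniteQAlgebraLattice`); sequel of
`FiniteQAlgebraLatticePicardExtensionSurjective` (Thm. 8.2 (e): `#G([Λ_2]_ε) = #G([Λ_1]_ε) · #ker_ε`),
`FiniteQAlgebraLatticeConductorKernelBijection` (Thm. 8.2 (d): `a ↦ C + aΛ_2` maps `(Λ_1/C)^{unit}` ONTO the
lattice kernel `ker = {K ∈ G(Λ_2) | Λ_1K = Λ_1}` with fibres the `(Λ_2/C)^{unit}`-cosets) and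
`FiniteQAlgebraLatticeOrderExtensionKernel` (`C + aΛ_2 ∈ ker`).  Lane `lit-hodgefound` (Track 2 foundations
library), seat p19 generation 37, row g37-#12.  THEOREMS ONLY: no definition, no instance, no notation, no named fact
(D-0026, net Literature debt `0`), no `sorry`.

DEF-FREE SPELLING.  For orders `Λ_2 ⊆ Λ_1` (`1 ∈ Λ_i`, `Λ_iΛ_i ⊆ Λ_i`, full) and `C := Λ_2 / Λ_1` (the conductor
`Λ_2:Λ_1`):
* `G(Λ_2)` = `{M // IsFullLattice A M ∧ M / M = Λ_2 ∧ M * ((M / M) / M) = M / M}`, `G([Λ_2]_ε)` its `Quot` by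
  `∃ u : Aˣ, u • M = M'` (as in `FiniteQAlgebraLatticeInvertibleClassesFinite`);
* the LATTICE KERNEL `ker(G(Λ_2) → G(Λ_1))` = `{K // K ∈ G(Λ_2) ∧ Λ_1 * K = Λ_1}`; the CLASS KERNEL
  `ker(G([Λ_2]_ε) → G([Λ_1]_ε))` = `{q // ∃ M, [M] = q ∧ ∃ u, u • (Λ_1M) = Λ_1}` (as in `…PicardExtensionSurjective`);
* `Λ^{unit}` = `{u : Aˣ // ↑u ∈ Λ ∧ ↑u⁻¹ ∈ Λ}` and the INDEX `[Λ_1^{unit} : Λ_2^{unit}]` = `Nat.card` of the `Quot` of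
  `Λ_1^{unit}` by `v = uw` for some `w ∈ Λ_2^{unit}`;
* `(Λ/C)^{unit}` = the `Quot` of `{a // a ∈ Λ ∧ ∃ a' ∈ Λ, aa' − 1 ∈ C}` by `a − b ∈ C`, and `|·|` is `Nat.card`.
All identities below are identities of `Nat.card` proved through explicit bijections (so they hold verbatim also
where HL first prove finiteness; every factor IS finite for finite-dimensional `A`).

## Sources, VERBATIM

C. Hertling, K. Larabi, *Semigroups from full lattices in commutative ℚ-algebras*, arXiv:2602.14973 (2026)
[HertlingLarabi2026], held `paper:arxiv-2602.14973`, §8 Thm. 8.2 (chunk p0021): «Let `Λ_1` and `Λ_2` be two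
orders in `A` with `Λ_2 ⊊ Λ_1`. The full lattice `C := Λ_2:Λ_1` is called conductor of the pair `(Λ_1, Λ_2)`. […]
(b) The following sequence is exact, `1 → ∏_{p∈P_0}(Λ_2)_(p)^{unit} → ∏_{p∈P_0}(Λ_1)_(p)^{unit} → G(Λ_2) → G(Λ_1)
→ 1`. […] (c) There is a natural isomorphism of groups `(Λ_1/C)^{unit}/(Λ_2/C)^{unit} →
⊕_{p∈P_0}(Λ_1)_(p)^{unit}/(Λ_2)_(p)^{unit}` (8.4). (d) The isomorphism of groups
`(Λ_1/C)^{unit}/(Λ_2/C)^{unit} → ker(G(Λ_2) → G(Λ_1))` which results from (b) and (c) is given by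
`((a + C) mod (Λ_2/C)^{unit}) ↦ C + aΛ_2` (8.6), where `a ∈ Λ_1`, `a + C ∈ (Λ_1/C)^{unit} ⊂ Λ_1/C`. (e) The maps
in the following sequence are the natural ones, the sequence is exact,
`1 → Λ_2^{unit} → Λ_1^{unit} → ∏_{p∈P_0}(Λ_1)_(p)^{unit}/(Λ_2)_(p)^{unit} → G([Λ_2]_ε) → G([Λ_1]_ε) → 1`. […]
(f) The group `Λ_2^{unit}` has finite index in the group `Λ_1^{unit}`. By Theorem 6.5 the groups `G([Λ_2]_ε)`
and `G[Λ_1]_ε)` are finite. The size of one of them can be calculated by the size of the other one with the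
following formula, `|G([Λ_2]_ε)|/|G([Λ_1]_ε)| = |(Λ_1/C)^{unit}|/|(Λ_2/C)^{unit}| · 1/[Λ_1^{unit} : Λ_2^{unit}]`
(8.10).»  Rem. 8.3 (chunk p0023): «Theorem (12.12) in [Ne99] is a special case of part (f) of Theorem 8.2.»

C. Hertling, K. Larabi, *Conjugacy classes of regular integer matrices*, arXiv:2602.15748 (2026)
[HertlingLarabi2026b], held `paper:arxiv-2602.15748`, §5 Thm. 5.12 (chunk p0011): «(c) The following sequence is
exact, `1 → (Λ_2/C)^{unit} → (Λ_1/C)^{unit} → G(Λ_2) → G(Λ_1) → 1`. […] Here the image in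
`ker(G(Λ_2) → G(Λ_1))` of an element `a + C ∈ (Λ_1/C)^{unit}` with `a ∈ Λ_1` is `C + aΛ_2`. (d) […]
`1 → Λ_2^{unit} → Λ_1^{unit} → (Λ_1/C)^{unit}/(Λ_2/C)^{unit} → G([Λ_2]_ε) → G([Λ_1]_ε) → 1`. […] (e) The group
`Λ_2^{unit}` has finite index in the group `Λ_1^{unit}`. The groups `(Λ_1/C)^{unit}` and `(Λ_2/C)^{unit}` are
finite. […] `|G([Λ_2]_ε)|/|G([Λ_1]_ε)| = |(Λ_1/C)^{unit}|/|(Λ_2/C)^{unit}| · 1/[Λ_1^{unit} : Λ_2^{unit}]` (5.22).»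

## The two counts (HL's exactness of (b)–(e), as bijections)

(i) EXACTNESS AT `G([Λ_2]_ε)` ((e); HL's «Claim»): `K ↦ [K]_ε` maps the lattice kernel ONTO the class kernel
(`[L̃]_ε ∈ ker` iff `Λ_1L̃ = aΛ_1`, then `a⁻¹L̃` lies in the lattice kernel), and its fibre through `K_0` is the
orbit `Λ_1^{unit}K_0` (`Λ_1(uK_0) = uΛ_1 = Λ_1` iff `u ∈ Λ_1^{unit}`) with stabiliser `{u | uK_0 = K_0} =
𝒪(K_0)^{unit} = Λ_2^{unit}` (`units_smul_eq_self_iff`): `#ker_lattice = #ker_ε · [Λ_1^{unit} : Λ_2^{unit}]`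
(`natCard_kerLat_eq_natCard_ker_mul_index`).  (ii) THE ISOMORPHISM (c)+(d): `a ↦ C + aΛ_2` is onto the lattice
kernel with fibres `a(Λ_2/C)^{unit}`, on which `(Λ_2/C)^{unit}` acts freely (`a` is invertible mod `C`):
`#(Λ_1/C)^{unit} = #ker_lattice · #(Λ_2/C)^{unit}` (`natCard_unitsModConductor_eq_natCard_kerLat_mul`).  With
`#G([Λ_2]_ε) = #G([Λ_1]_ε) · #ker_ε` (`…PicardExtensionSurjective`) the formula (8.10) follows
(`natCard_quot_pic_mul_mul_index_eq`).  §4: every factor is FINITE and NONZERO — `finite_kerLat`,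
`natCard_kerLat_ne_zero`, `natCard_unitsIndex_ne_zero` («`Λ_2^{unit}` has finite index in `Λ_1^{unit}`»),
`finite_unitsModConductor(_of_orders)` («`(Λ_1/C)^{unit}` and `(Λ_2/C)^{unit}` are finite»).

## References

* [HertlingLarabi2026] C. Hertling, K. Larabi, arXiv:2602.14973 (2026), §8 Thm. 8.2 (b)–(f) (8.4), (8.6), (8.10),
  Rem. 8.3 (chunks p0021–p0023). [cite: HertlingLarabi2026, §8 Thm. 8.2 (c)–(f) (8.10), chunk p0021]
* [HertlingLarabi2026b] C. Hertling, K. Larabi, arXiv:2602.15748 (2026), §5 Thm. 5.12 (c)–(e) (5.22) (chunk p0011).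
  [cite: HertlingLarabi2026b, §5 Thm. 5.12 (c)–(e), chunk p0011]
* [NeukirchANT1999] J. Neukirch, *Algebraic Number Theory* (1999), I §12 Prop. (12.9), (12.11), Thm. (12.12) (one
  number field: `h(𝒪) = h_K · #(𝒪_K/𝔣)^*/(#(𝒪/𝔣)^* · [𝒪_K^* : 𝒪^*])`), as identified by [HertlingLarabi2026]
  Rem. 8.3. [cite: NeukirchANT1999, I §12 Thm. (12.12)]
-/

noncomputable section

open scoped Classical Pointwise
open Module Function Submodule

open Literature.NumberTheory.Automorphic (IsFullLattice mem_units_smul_submodule_iff)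
open Literature.LinearAlgebra.Matrix.LatimerMacDuffeeSquarefree (equivalence_exists_units_smul)

namespace Literature.NumberTheory.ComplexMultiplication.FiniteQAlgebraLattice

section ClassNumberFormula

variable {A : Type} [CommRing A] [Algebra ℚ A]

/-! ## §0 Tools: the stabiliser of a lattice in `A^{unit}`; counting along a map with equal fibres -/

omit [Algebra ℚ A] in
/-- **The STABILISER of a lattice: `uK = K` iff `u, u⁻¹ ∈ 𝒪(K) = K:K`** (so for `K ∈ G(Λ)`: iff `u ∈ Λ^{unit}`;
LEMMA 5.5 «`𝒪(aL) = 𝒪(L)`»). [cite: HertlingLarabi2026, §5 Lemma 5.5 and §8 Thm. 8.2 (e) (the map `Λ_1^{unit} → … → G([Λ_2]_ε)`), chunks p0012, p0021] -/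
theorem units_smul_eq_self_iff (u : Aˣ) (K : Submodule ℤ A) :
    u • K = K ↔ (u : A) ∈ K / K ∧ ((u⁻¹ : Aˣ) : A) ∈ K / K := by
  constructor
  · intro h
    refine ⟨mem_div_iff_forall_mul_mem.2 fun k hk => ?_, mem_div_iff_forall_mul_mem.2 fun k hk => ?_⟩
    · have hk' : u • k ∈ u • K := smul_mem_pointwise_smul k u K hk
      rw [h, Units.smul_def, smul_eq_mul] at hk'
      exact hk'
    · have hk' : k ∈ u • K := by rwa [h]
      rw [mem_units_smul_submodule_iff, Units.smul_def, smul_eq_mul] at hk'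
      exact hk'
  · rintro ⟨hu, hu'⟩
    refine le_antisymm (fun x hx => ?_) (fun x hx => ?_)
    · rw [mem_units_smul_submodule_iff, Units.smul_def, smul_eq_mul] at hx
      have h := (mem_div_iff_forall_mul_mem.1 hu) _ hx
      rwa [Units.mul_inv_cancel_left] at h
    · rw [mem_units_smul_submodule_iff, Units.smul_def, smul_eq_mul]
      exact (mem_div_iff_forall_mul_mem.1 hu') _ hx

/-- Counting along a map all of whose fibres are in bijection with one type. [folklore] -/
private theorem natCard_eq_mul_of_fiber_equiv {α β γ : Type} (f : α → β)
    (h : ∀ b, Nonempty ({a : α // f a = b} ≃ γ)) : Nat.card α = Nat.card β * Nat.card γ := by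
  rw [← Nat.card_congr (Equiv.sigmaFiberEquiv f), Nat.card_congr (Equiv.sigmaCongrRight fun b => (h b).some),
    Nat.card_congr (Equiv.sigmaEquivProd β γ), Nat.card_prod]

omit [Algebra ℚ A] in
/-- Congruence modulo a submodule is an equivalence relation on any subtype. [folklore] -/
private theorem equivalence_sub_mem (p : A → Prop) (C : Submodule ℤ A) :
    Equivalence fun a b : {a : A // p a} => a.1 - b.1 ∈ C where
  refl a := by rw [sub_self]; exact C.zero_mem
  symm := fun {a b} h => by rw [← neg_sub]; exact C.neg_mem h
  trans := fun {a b c} h h' => by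
    have := C.add_mem h h'
    rwa [sub_add_sub_cancel] at this

/-! ## §1 Theorem 8.2 (e): `#ker(G(Λ_2) → G(Λ_1)) = #ker(G([Λ_2]_ε) → G([Λ_1]_ε)) · [Λ_1^{unit} : Λ_2^{unit}]` -/

omit [Algebra ℚ A] in
/-- **THEOREM 8.2 (e) ∕ 5.12 (d), EXACTNESS at `G([Λ_2]_ε)` and at `Λ_1^{unit}`, counting form: for orders
`Λ_2 ⊆ Λ_1`, `#ker(G(Λ_2) → G(Λ_1)) = #ker(G([Λ_2]_ε) → G([Λ_1]_ε)) · [Λ_1^{unit} : Λ_2^{unit}]`** — `K ↦ [K]_ε`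
maps the lattice kernel `{K ∈ G(Λ_2) | Λ_1K = Λ_1}` onto the class kernel («Consider `L̃ ∈ G(Λ_2)` with
`[L̃]_ε ∈ ker […]`. Then `[Λ_1L̃]_ε = [Λ_1]_ε`, so an element `a ∈ A^{unit}` with `Λ_1L̃ = aΛ_1` exists»: `a⁻¹L̃`
is in the lattice kernel), each fibre is an orbit of `Λ_1^{unit}` (`Λ_1(uK) = uΛ_1`) with stabiliser
`𝒪(K)^{unit} = Λ_2^{unit}`, so it is in bijection with `Λ_1^{unit}/Λ_2^{unit}`.
[cite: HertlingLarabi2026, §8 Thm. 8.2 (e) (exactness; proof, the Claim), chunks p0021–p0023]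
[cite: HertlingLarabi2026b, §5 Thm. 5.12 (d), chunk p0011] [cite: NeukirchANT1999, I §12 Prop. (12.9)] -/
theorem natCard_kerLat_eq_natCard_ker_mul_index {Λ₁ Λ₂ : Submodule ℤ A} (h1 : (1 : A) ∈ Λ₁)
    (hΛ₁Λ₁ : Λ₁ * Λ₁ ≤ Λ₁) :
    Nat.card {K : Submodule ℤ A //
        (IsFullLattice A K ∧ K / K = Λ₂ ∧ K * ((K / K) / K) = K / K) ∧ Λ₁ * K = Λ₁} =
      Nat.card {q : Quot (fun M M' : {M : Submodule ℤ A //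
            IsFullLattice A M ∧ M / M = Λ₂ ∧ M * ((M / M) / M) = M / M} => ∃ u : Aˣ, u • M.1 = M'.1) //
          ∃ M : {M : Submodule ℤ A // IsFullLattice A M ∧ M / M = Λ₂ ∧ M * ((M / M) / M) = M / M},
            Quot.mk _ M = q ∧ ∃ u : Aˣ, u • (Λ₁ * M.1) = Λ₁} *
      Nat.card (Quot fun u v : {u : Aˣ // (u : A) ∈ Λ₁ ∧ ((u⁻¹ : Aˣ) : A) ∈ Λ₁} =>
          ∃ w : Aˣ, (w : A) ∈ Λ₂ ∧ ((w⁻¹ : Aˣ) : A) ∈ Λ₂ ∧ (v.1 : Aˣ) = u.1 * w) := by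
  have hE := equivalence_exists_units_smul
    (fun M : Submodule ℤ A => IsFullLattice A M ∧ M / M = Λ₂ ∧ M * ((M / M) / M) = M / M)
  have hO₁ : Λ₁ / Λ₁ = Λ₁ := div_self_eq_of_one_mem h1 hΛ₁Λ₁
  -- `uΛ₁ = Λ₁ ↔ u ∈ Λ₁^{unit}`
  have hU₁ : ∀ u : Aˣ, u • Λ₁ = Λ₁ ↔ (u : A) ∈ Λ₁ ∧ ((u⁻¹ : Aˣ) : A) ∈ Λ₁ := fun u => by
    rw [units_smul_eq_self_iff, hO₁]
  -- translates stay in `G(Λ₂)`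
  have hG : ∀ (u : Aˣ) {M : Submodule ℤ A}, IsFullLattice A M ∧ M / M = Λ₂ ∧ M * ((M / M) / M) = M / M →
      IsFullLattice A (u • M) ∧ (u • M) / (u • M) = Λ₂ ∧
        (u • M) * (((u • M) / (u • M)) / (u • M)) = (u • M) / (u • M) := fun u M hM =>
    ⟨IsFullLattice.units_smul _ hM.1, by rw [div_self_units_smul, hM.2.1], units_smul_mul_div_div_eq _ hM.2.2⟩
  refine natCard_eq_mul_of_fiber_equiv
    (fun K => ⟨Quot.mk _ ⟨K.1, K.2.1⟩, ⟨K.1, K.2.1⟩, rfl, 1, by rw [one_smul]; exact K.2.2⟩) fun q => ?_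
  -- a point `K₀ = u₀M` of the fibre over `q = [M]`, `u₀Λ₁M = Λ₁`
  obtain ⟨M, hMq, u₀, hu₀⟩ := q.2
  have hK₀ker : Λ₁ * (u₀ • M.1) = Λ₁ := by rw [units_smul_order_mul, hu₀]
  let K₀ : {K : Submodule ℤ A //
      (IsFullLattice A K ∧ K / K = Λ₂ ∧ K * ((K / K) / K) = K / K) ∧ Λ₁ * K = Λ₁} :=
    ⟨u₀ • M.1, hG u₀ M.2, hK₀ker⟩
  have hK₀q : Quot.mk (fun M M' : {M : Submodule ℤ A //
        IsFullLattice A M ∧ M / M = Λ₂ ∧ M * ((M / M) / M) = M / M} => ∃ u : Aˣ, u • M.1 = M'.1)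
      ⟨K₀.1, K₀.2.1⟩ = q.1 := by
    rw [← hMq]
    exact (Quot.sound ⟨u₀, rfl⟩).symm
  -- `θ : Λ₁^{unit}/Λ₂^{unit} → fibre`, `[u] ↦ uK₀`
  have hθker : ∀ u : {u : Aˣ // (u : A) ∈ Λ₁ ∧ ((u⁻¹ : Aˣ) : A) ∈ Λ₁}, Λ₁ * (u.1 • K₀.1) = Λ₁ := fun u => by
    rw [units_smul_order_mul, hK₀ker, (hU₁ u.1).2 u.2]
  let θ₀ : {u : Aˣ // (u : A) ∈ Λ₁ ∧ ((u⁻¹ : Aˣ) : A) ∈ Λ₁} →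
      {K : {K : Submodule ℤ A //
          (IsFullLattice A K ∧ K / K = Λ₂ ∧ K * ((K / K) / K) = K / K) ∧ Λ₁ * K = Λ₁} //
        (⟨Quot.mk _ ⟨K.1, K.2.1⟩, ⟨K.1, K.2.1⟩, rfl, 1, by rw [one_smul]; exact K.2.2⟩ :
          {q : Quot (fun M M' : {M : Submodule ℤ A //
              IsFullLattice A M ∧ M / M = Λ₂ ∧ M * ((M / M) / M) = M / M} => ∃ u : Aˣ, u • M.1 = M'.1) //
            ∃ M : {M : Submodule ℤ A // IsFullLattice A M ∧ M / M = Λ₂ ∧ M * ((M / M) / M) = M / M},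
              Quot.mk _ M = q ∧ ∃ u : Aˣ, u • (Λ₁ * M.1) = Λ₁}) = q} := fun u =>
    ⟨⟨u.1 • K₀.1, hG u.1 K₀.2.1, hθker u⟩, Subtype.ext (by
      change Quot.mk _ _ = q.1
      rw [← hK₀q]
      exact (Quot.sound ⟨u.1, rfl⟩).symm)⟩
  have hθ₀ : ∀ u, (θ₀ u).1.1 = u.1 • K₀.1 := fun u => rfl
  -- the stabiliser of `K₀` is `Λ₂^{unit}`
  have hstab : ∀ w : Aˣ, w • K₀.1 = K₀.1 ↔ (w : A) ∈ Λ₂ ∧ ((w⁻¹ : Aˣ) : A) ∈ Λ₂ := fun w => by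
    rw [units_smul_eq_self_iff, K₀.2.1.2.1]
  let θ : Quot (fun u v : {u : Aˣ // (u : A) ∈ Λ₁ ∧ ((u⁻¹ : Aˣ) : A) ∈ Λ₁} =>
        ∃ w : Aˣ, (w : A) ∈ Λ₂ ∧ ((w⁻¹ : Aˣ) : A) ∈ Λ₂ ∧ (v.1 : Aˣ) = u.1 * w) → _ :=
    Quot.lift θ₀ fun u v ⟨w, hw, hw', hvw⟩ => Subtype.ext (Subtype.ext (by
      rw [hθ₀, hθ₀, hvw, mul_smul, (hstab w).2 ⟨hw, hw'⟩]))
  refine ⟨(Equiv.ofBijective θ ⟨?_, ?_⟩).symm⟩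
  · -- injective: `uK₀ = vK₀ ⟹ u⁻¹v ∈ Stab(K₀) = Λ₂^{unit}`
    rintro ⟨u⟩ ⟨v⟩ huv
    have h : u.1 • K₀.1 = v.1 • K₀.1 := by
      rw [← hθ₀ u, ← hθ₀ v]
      exact congrArg (fun x => x.1.1) huv
    have hw : (u.1⁻¹ * v.1) • K₀.1 = K₀.1 := by rw [mul_smul, ← h, inv_smul_smul]
    obtain ⟨hw₁, hw₂⟩ := (hstab _).1 hw
    exact Quot.sound ⟨u.1⁻¹ * v.1, hw₁, hw₂, (mul_inv_cancel_left u.1 v.1).symm⟩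
  · -- surjective: `K ∼_ε K₀` in the fibre gives `K = uK₀` with `uΛ₁ = Λ₁`
    rintro ⟨K, hK⟩
    have hKq : Quot.mk (fun M M' : {M : Submodule ℤ A //
          IsFullLattice A M ∧ M / M = Λ₂ ∧ M * ((M / M) / M) = M / M} => ∃ u : Aˣ, u • M.1 = M'.1)
        ⟨K.1, K.2.1⟩ = q.1 := congrArg Subtype.val hK
    obtain ⟨u, hu⟩ := hE.eqvGen_iff.1 (Quot.eqvGen_exact (hK₀q.trans hKq.symm))
    change u • K₀.1 = K.1 at hu
    have huΛ₁ : (u : A) ∈ Λ₁ ∧ ((u⁻¹ : Aˣ) : A) ∈ Λ₁ := (hU₁ u).1 (by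
      have h := K.2.2
      rw [← hu, units_smul_order_mul, hK₀ker] at h
      exact h)
    exact ⟨Quot.mk _ ⟨u, huΛ₁⟩, Subtype.ext (Subtype.ext hu)⟩

/-! ## §2 Theorem 8.2 (c)+(d): `#(Λ_1/C)^{unit} = #ker(G(Λ_2) → G(Λ_1)) · #(Λ_2/C)^{unit}` -/

/-- **THEOREM 8.2 (c)+(d) ∕ 5.12 (c), EXACTNESS at `(Λ_1/C)^{unit}` and at `G(Λ_2)`, counting form: for orders
`Λ_2 ⊆ Λ_1` with conductor `C = Λ_2:Λ_1`, `#(Λ_1/C)^{unit} = #ker(G(Λ_2) → G(Λ_1)) · #(Λ_2/C)^{unit}`** —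
`a + C ↦ C + aΛ_2` maps `(Λ_1/C)^{unit}` ONTO the lattice kernel («the image in `ker(G(Λ_2) → G(Λ_1))` of an
element `a + C ∈ (Λ_1/C)^{unit}` […] is `C + aΛ_2`»; `…ConductorKernelBijection.exists_eq_conductor_sup_map_mulLeft`),
with fibres the cosets `a(Λ_2/C)^{unit}` (`conductor_sup_map_mulLeft_eq_iff`), on which `(Λ_2/C)^{unit}` acts freely
because `a` is invertible modulo `C` — the isomorphism (8.6) `(Λ_1/C)^{unit}/(Λ_2/C)^{unit} ≅ ker`.
[cite: HertlingLarabi2026, §8 Thm. 8.2 (c), (d) (8.4), (8.6), chunks p0021–p0022]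
[cite: HertlingLarabi2026b, §5 Thm. 5.12 (c) (5.21), chunk p0011] [cite: NeukirchANT1999, I §12 Prop. (12.11)] -/
theorem natCard_unitsModConductor_eq_natCard_kerLat_mul {Λ₁ Λ₂ : Submodule ℤ A}
    (hΛ₁ : IsFullLattice A Λ₁) (h1 : (1 : A) ∈ Λ₁) (hΛ₁Λ₁ : Λ₁ * Λ₁ ≤ Λ₁)
    (hΛ₂ : IsFullLattice A Λ₂) (h2 : (1 : A) ∈ Λ₂) (hΛ₂Λ₂ : Λ₂ * Λ₂ ≤ Λ₂) (hle : Λ₂ ≤ Λ₁) :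
    Nat.card (Quot fun a b : {a : A // a ∈ Λ₁ ∧ ∃ a' ∈ Λ₁, a * a' - 1 ∈ Λ₂ / Λ₁} =>
        a.1 - b.1 ∈ Λ₂ / Λ₁) =
      Nat.card {K : Submodule ℤ A //
          (IsFullLattice A K ∧ K / K = Λ₂ ∧ K * ((K / K) / K) = K / K) ∧ Λ₁ * K = Λ₁} *
      Nat.card (Quot fun a b : {a : A // a ∈ Λ₂ ∧ ∃ a' ∈ Λ₂, a * a' - 1 ∈ Λ₂ / Λ₁} =>
        a.1 - b.1 ∈ Λ₂ / Λ₁) := by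
  have hE₁ := equivalence_sub_mem (fun a : A => a ∈ Λ₁ ∧ ∃ a' ∈ Λ₁, a * a' - 1 ∈ Λ₂ / Λ₁) (Λ₂ / Λ₁)
  -- `C` is an ideal of `Λ₁` inside `Λ₂`
  have hΛ₁C : Λ₁ * (Λ₂ / Λ₁) = Λ₂ / Λ₁ :=
    le_antisymm (conductor_mul_le h1 hΛ₁Λ₁) fun y hy => by rw [← one_mul y]; exact mul_mem_mul h1 hy
  have hCmul₁ : ∀ x ∈ Λ₁, ∀ c ∈ Λ₂ / Λ₁, x * c ∈ Λ₂ / Λ₁ := fun x hx c hc => by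
    rw [← hΛ₁C]; exact mul_mem_mul hx hc
  have hCmul : ∀ c ∈ Λ₂ / Λ₁, ∀ y ∈ Λ₂, c * y ∈ Λ₂ / Λ₁ := fun c hc y hy => by
    rw [mul_comm]; exact hCmul₁ y (hle hy) c hc
  -- `Ψ : (Λ₁/C)^{unit} → ker`, `a + C ↦ C + aΛ₂` (Thm. 8.2 (d), well defined)
  have hΨ₀ : ∀ a : {a : A // a ∈ Λ₁ ∧ ∃ a' ∈ Λ₁, a * a' - 1 ∈ Λ₂ / Λ₁},
      (IsFullLattice A (Λ₂ / Λ₁ ⊔ Λ₂.map (LinearMap.mulLeft ℤ a.1)) ∧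
        (Λ₂ / Λ₁ ⊔ Λ₂.map (LinearMap.mulLeft ℤ a.1)) / (Λ₂ / Λ₁ ⊔ Λ₂.map (LinearMap.mulLeft ℤ a.1)) = Λ₂ ∧
        (Λ₂ / Λ₁ ⊔ Λ₂.map (LinearMap.mulLeft ℤ a.1)) *
            (((Λ₂ / Λ₁ ⊔ Λ₂.map (LinearMap.mulLeft ℤ a.1)) / (Λ₂ / Λ₁ ⊔ Λ₂.map (LinearMap.mulLeft ℤ a.1))) /
              (Λ₂ / Λ₁ ⊔ Λ₂.map (LinearMap.mulLeft ℤ a.1))) =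
          (Λ₂ / Λ₁ ⊔ Λ₂.map (LinearMap.mulLeft ℤ a.1)) / (Λ₂ / Λ₁ ⊔ Λ₂.map (LinearMap.mulLeft ℤ a.1))) ∧
      Λ₁ * (Λ₂ / Λ₁ ⊔ Λ₂.map (LinearMap.mulLeft ℤ a.1)) = Λ₁ := fun a => by
    obtain ⟨ha, a', ha', haa'⟩ := a.2
    have h := conductor_sup_map_mulLeft_mem_ker hΛ₁ h1 hΛ₁Λ₁ hΛ₂ h2 hΛ₂Λ₂ hle ha ha' haa'
    exact ⟨⟨h.1, h.2.1, h.2.2.1⟩, h.2.2.2⟩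
  let Ψ₀ : {a : A // a ∈ Λ₁ ∧ ∃ a' ∈ Λ₁, a * a' - 1 ∈ Λ₂ / Λ₁} →
      {K : Submodule ℤ A // (IsFullLattice A K ∧ K / K = Λ₂ ∧ K * ((K / K) / K) = K / K) ∧ Λ₁ * K = Λ₁} :=
    fun a => ⟨_, hΨ₀ a⟩
  have hΨ₀v : ∀ a, (Ψ₀ a).1 = Λ₂ / Λ₁ ⊔ Λ₂.map (LinearMap.mulLeft ℤ a.1) := fun a => rfl
  let Ψ : Quot (fun a b : {a : A // a ∈ Λ₁ ∧ ∃ a' ∈ Λ₁, a * a' - 1 ∈ Λ₂ / Λ₁} => a.1 - b.1 ∈ Λ₂ / Λ₁) →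
      {K : Submodule ℤ A // (IsFullLattice A K ∧ K / K = Λ₂ ∧ K * ((K / K) / K) = K / K) ∧ Λ₁ * K = Λ₁} :=
    Quot.lift Ψ₀ fun a b hab => Subtype.ext (by
      rw [hΨ₀v, hΨ₀v]
      exact (conductor_sup_map_mulLeft_eq_iff h1 hΛ₁Λ₁ h2 hΛ₂Λ₂ hle a.2.1 a.2.2).2
        ⟨1, h2, ⟨1, h2, by rw [mul_one, sub_self]; exact zero_mem _⟩,
          by rw [mul_one, ← neg_sub]; exact (Λ₂ / Λ₁).neg_mem hab⟩)
  have hΨ : ∀ a, Ψ (Quot.mk _ a) = Ψ₀ a := fun a => rfl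
  refine natCard_eq_mul_of_fiber_equiv Ψ fun K => ?_
  -- `K = C + a₀Λ₂` with `a₀ + C ∈ (Λ₁/C)^{unit}` (Thm. 8.2 (d), surjectivity)
  obtain ⟨a₀, ha₀, ⟨a₀', ha₀', ha₀a₀'⟩, hKa₀⟩ := exists_eq_conductor_sup_map_mulLeft hΛ₁ h1 hΛ₁Λ₁ hΛ₂ h2 hΛ₂Λ₂
    hle K.2.1.1 K.2.1.2.1 K.2.1.2.2 K.2.2
  -- `a₀v + C ∈ (Λ₁/C)^{unit}` for `v + C ∈ (Λ₂/C)^{unit}`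
  have hmulU : ∀ v : {a : A // a ∈ Λ₂ ∧ ∃ a' ∈ Λ₂, a * a' - 1 ∈ Λ₂ / Λ₁},
      a₀ * v.1 ∈ Λ₁ ∧ ∃ a' ∈ Λ₁, a₀ * v.1 * a' - 1 ∈ Λ₂ / Λ₁ := fun v => by
    obtain ⟨hv, v', hv', hvv'⟩ := v.2
    refine ⟨hΛ₁Λ₁ (mul_mem_mul ha₀ (hle hv)), a₀' * v', hΛ₁Λ₁ (mul_mem_mul ha₀' (hle hv')), ?_⟩
    have e : a₀ * v.1 * (a₀' * v') - 1 = (a₀ * a₀' - 1) * (v.1 * v') + (v.1 * v' - 1) := by ring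
    rw [e]
    exact (Λ₂ / Λ₁).add_mem (hCmul _ ha₀a₀' _ (hΛ₂Λ₂ (mul_mem_mul hv hv'))) hvv'
  -- `ρ : (Λ₂/C)^{unit} → fibre over K`, `v + C ↦ a₀v + C`
  let ρ₀ : {a : A // a ∈ Λ₂ ∧ ∃ a' ∈ Λ₂, a * a' - 1 ∈ Λ₂ / Λ₁} →
      {x : Quot (fun a b : {a : A // a ∈ Λ₁ ∧ ∃ a' ∈ Λ₁, a * a' - 1 ∈ Λ₂ / Λ₁} =>
        a.1 - b.1 ∈ Λ₂ / Λ₁) // Ψ x = K} := fun v =>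
    ⟨Quot.mk _ ⟨a₀ * v.1, hmulU v⟩, by
      rw [hΨ]
      refine Subtype.ext ?_
      rw [hΨ₀v, hKa₀]
      obtain ⟨hv, v', hv', hvv'⟩ := v.2
      exact ((conductor_sup_map_mulLeft_eq_iff h1 hΛ₁Λ₁ h2 hΛ₂Λ₂ hle ha₀ ⟨a₀', ha₀', ha₀a₀'⟩).2
        ⟨v.1, hv, ⟨v', hv', hvv'⟩, by rw [sub_self]; exact zero_mem _⟩).symm⟩
  have hρ₀ : ∀ v, (ρ₀ v).1 = Quot.mk _ ⟨a₀ * v.1, hmulU v⟩ := fun v => rfl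
  let ρ : Quot (fun a b : {a : A // a ∈ Λ₂ ∧ ∃ a' ∈ Λ₂, a * a' - 1 ∈ Λ₂ / Λ₁} => a.1 - b.1 ∈ Λ₂ / Λ₁) →
      {x : Quot (fun a b : {a : A // a ∈ Λ₁ ∧ ∃ a' ∈ Λ₁, a * a' - 1 ∈ Λ₂ / Λ₁} =>
        a.1 - b.1 ∈ Λ₂ / Λ₁) // Ψ x = K} :=
    Quot.lift ρ₀ fun v v' hvv' => Subtype.ext (by
      rw [hρ₀, hρ₀]
      refine Quot.sound ?_
      change a₀ * v.1 - a₀ * v'.1 ∈ Λ₂ / Λ₁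
      rw [← mul_sub]
      exact hCmul₁ a₀ ha₀ _ hvv')
  refine ⟨(Equiv.ofBijective ρ ⟨?_, ?_⟩).symm⟩
  · -- injective: `a₀v ≡ a₀v' (mod C) ⟹ v ≡ v'`, as `a₀` is invertible modulo `C`
    rintro ⟨v⟩ ⟨v'⟩ h
    have h' : Quot.mk (fun a b : {a : A // a ∈ Λ₁ ∧ ∃ a' ∈ Λ₁, a * a' - 1 ∈ Λ₂ / Λ₁} =>
        a.1 - b.1 ∈ Λ₂ / Λ₁) ⟨a₀ * v.1, hmulU v⟩ = Quot.mk _ ⟨a₀ * v'.1, hmulU v'⟩ := by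
      rw [← hρ₀ v, ← hρ₀ v']
      exact congrArg Subtype.val h
    have hC : a₀ * v.1 - a₀ * v'.1 ∈ Λ₂ / Λ₁ := hE₁.eqvGen_iff.1 (Quot.eqvGen_exact h')
    refine Quot.sound ?_
    have e : v.1 - v'.1 = a₀' * (a₀ * v.1 - a₀ * v'.1) - (a₀ * a₀' - 1) * (v.1 - v'.1) := by ring
    rw [e]
    exact (Λ₂ / Λ₁).sub_mem (hCmul₁ a₀' ha₀' _ hC) (hCmul _ ha₀a₀' _ (Λ₂.sub_mem v.2.1 v'.2.1))
  · -- surjective: `C + bΛ₂ = C + a₀Λ₂ ⟹ b ≡ a₀v (mod C)` (Thm. 8.2 (d), fibres)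
    rintro ⟨x, hx⟩
    induction x using Quot.ind with | mk b => ?_
    have hb : Λ₂ / Λ₁ ⊔ Λ₂.map (LinearMap.mulLeft ℤ a₀) = Λ₂ / Λ₁ ⊔ Λ₂.map (LinearMap.mulLeft ℤ b.1) := by
      rw [← hKa₀, ← hΨ₀v b]
      exact (congrArg Subtype.val hx).symm
    obtain ⟨v, hv, hvu, hbv⟩ :=
      (conductor_sup_map_mulLeft_eq_iff h1 hΛ₁Λ₁ h2 hΛ₂Λ₂ hle ha₀ ⟨a₀', ha₀', ha₀a₀'⟩).1 hb
    refine ⟨Quot.mk _ ⟨v, hv, hvu⟩, Subtype.ext ?_⟩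
    change (ρ₀ ⟨v, hv, hvu⟩).1 = Quot.mk _ b
    rw [hρ₀]
    exact Quot.sound (show a₀ * v - b.1 ∈ Λ₂ / Λ₁ by rw [← neg_sub]; exact (Λ₂ / Λ₁).neg_mem hbv)

/-! ## §3 Theorem 8.2 (f) (8.10) ∕ 5.12 (e) (5.22): the class number formula -/

/-- **THEOREM 8.2 (f) (8.10) ∕ THEOREM 5.12 (e) (5.22) — THE CLASS NUMBER FORMULA of a pair of orders `Λ_2 ⊆ Λ_1`
of an ARBITRARY finite-dimensional commutative `ℚ`-algebra `A`, conductor `C = Λ_2:Λ_1`: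
`|G([Λ_2]_ε)| · |(Λ_2/C)^{unit}| · [Λ_1^{unit} : Λ_2^{unit}] = |G([Λ_1]_ε)| · |(Λ_1/C)^{unit}|`**, i.e.
«`|G([Λ_2]_ε)|/|G([Λ_1]_ε)| = |(Λ_1/C)^{unit}|/|(Λ_2/C)^{unit}| · 1/[Λ_1^{unit} : Λ_2^{unit}]`» (all five
cardinalities are finite: «By Theorem 6.5 the groups `G([Λ_2]_ε)` and `G[Λ_1]_ε)` are finite»,
`FiniteQAlgebraLatticeInvertibleClassesFinite.finite_quot_invertible`; «The group `Λ_2^{unit}` has finite index in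
the group `Λ_1^{unit}`»). From §1, §2 and `#G([Λ_2]_ε) = #G([Λ_1]_ε) · #ker` (Thm. 8.2 (e),
`natCard_quot_pic_eq_natCard_quot_pic_mul_natCard_ker`). [cite: HertlingLarabi2026, §8 Thm. 8.2 (f) (8.10), chunk p0021]
[cite: HertlingLarabi2026b, §5 Thm. 5.12 (e) (5.22), chunk p0011]
[cite: NeukirchANT1999, I §12 Thm. (12.12) (one number field), as identified by HertlingLarabi2026 Rem. 8.3] -/
theorem natCard_quot_pic_mul_mul_index_eq [Module.Finite ℚ A] {Λ₁ Λ₂ : Submodule ℤ A}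
    (hΛ₁ : IsFullLattice A Λ₁) (h1 : (1 : A) ∈ Λ₁) (hΛ₁Λ₁ : Λ₁ * Λ₁ ≤ Λ₁)
    (hΛ₂ : IsFullLattice A Λ₂) (h2 : (1 : A) ∈ Λ₂) (hΛ₂Λ₂ : Λ₂ * Λ₂ ≤ Λ₂) (hle : Λ₂ ≤ Λ₁) :
    Nat.card (Quot (fun M M' : {M : Submodule ℤ A //
        IsFullLattice A M ∧ M / M = Λ₂ ∧ M * ((M / M) / M) = M / M} => ∃ u : Aˣ, u • M.1 = M'.1)) *
      Nat.card (Quot fun a b : {a : A // a ∈ Λ₂ ∧ ∃ a' ∈ Λ₂, a * a' - 1 ∈ Λ₂ / Λ₁} =>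
        a.1 - b.1 ∈ Λ₂ / Λ₁) *
      Nat.card (Quot fun u v : {u : Aˣ // (u : A) ∈ Λ₁ ∧ ((u⁻¹ : Aˣ) : A) ∈ Λ₁} =>
        ∃ w : Aˣ, (w : A) ∈ Λ₂ ∧ ((w⁻¹ : Aˣ) : A) ∈ Λ₂ ∧ (v.1 : Aˣ) = u.1 * w) =
    Nat.card (Quot (fun M M' : {M : Submodule ℤ A //
        IsFullLattice A M ∧ M / M = Λ₁ ∧ M * ((M / M) / M) = M / M} => ∃ u : Aˣ, u • M.1 = M'.1)) *
      Nat.card (Quot fun a b : {a : A // a ∈ Λ₁ ∧ ∃ a' ∈ Λ₁, a * a' - 1 ∈ Λ₂ / Λ₁} =>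
        a.1 - b.1 ∈ Λ₂ / Λ₁) := by
  rw [natCard_quot_pic_eq_natCard_quot_pic_mul_natCard_ker hΛ₁ h1 hΛ₁Λ₁ hΛ₂ h2 hΛ₂Λ₂ hle,
    natCard_unitsModConductor_eq_natCard_kerLat_mul hΛ₁ h1 hΛ₁Λ₁ hΛ₂ h2 hΛ₂Λ₂ hle,
    natCard_kerLat_eq_natCard_ker_mul_index (Λ₂ := Λ₂) h1 hΛ₁Λ₁]
  ring

/-! ## §4 Theorem 8.2 (f) ∕ 5.12 (e): all factors are FINITE and NONZERO -/

/-- **The lattice kernel `ker(G(Λ_2) → G(Λ_1))` is FINITE** (its members lie between the conductor `C` and `Λ_1`,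
a finite window; HL: `≅ ⊕_{p∈P_0}(Λ_1)_(p)^{unit}/(Λ_2)_(p)^{unit}`, Thm. 8.2 (b), (c)).
[cite: HertlingLarabi2026, §8 Thm. 8.2 (b), (c) and §7 Thm. 7.6 (a) (finiteness of `Λ/L`), chunks p0019, p0021] -/
theorem finite_kerLat {Λ₁ Λ₂ : Submodule ℤ A} (hΛ₁ : IsFullLattice A Λ₁) (h1 : (1 : A) ∈ Λ₁)
    (hΛ₁Λ₁ : Λ₁ * Λ₁ ≤ Λ₁) (hΛ₂ : IsFullLattice A Λ₂) (h2 : (1 : A) ∈ Λ₂) (hle : Λ₂ ≤ Λ₁) :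
    Finite {K : Submodule ℤ A //
        (IsFullLattice A K ∧ K / K = Λ₂ ∧ K * ((K / K) / K) = K / K) ∧ Λ₁ * K = Λ₁} := by
  haveI : IsAddTorsionFree A := IsAddTorsionFree.of_isTorsionFree ℚ A
  obtain ⟨n, hn, hnC⟩ := Literature.NumberTheory.Automorphic.exists_smul_mem_of_fg
    (isFullLattice_div hΛ₂ hΛ₁) hΛ₁.1
  have hW := (Literature.NumberTheory.Automorphic.finite_setOf_le_and_smul_mem Λ₁ hΛ₁.1 hn).to_subtype
  refine Finite.of_injective (fun K : {K : Submodule ℤ A //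
      (IsFullLattice A K ∧ K / K = Λ₂ ∧ K * ((K / K) / K) = K / K) ∧ Λ₁ * K = Λ₁} =>
    (⟨K.1, fun x hx => ?_, fun x hx => ?_⟩ : {P : Submodule ℤ A | P ≤ Λ₁ ∧ ∀ x ∈ Λ₁, n • x ∈ P}))
    fun K K' h => Subtype.ext (congrArg (fun P : {P : Submodule ℤ A | P ≤ Λ₁ ∧ ∀ x ∈ Λ₁, n • x ∈ P} => P.1) h)
  · -- `K ⊆ Λ₁K = Λ₁`
    rw [← K.2.2, ← one_mul x]
    exact mul_mem_mul h1 hx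
  · -- `nΛ₁ ⊆ C ⊆ K`
    exact conductor_le_of_order_mul_eq h1 hΛ₁Λ₁ h2 hle K.2.1.1 K.2.1.2.1 K.2.1.2.2 K.2.2 (hnC x hx)

/-- **The lattice kernel is NONEMPTY and finite: `#ker(G(Λ_2) → G(Λ_1)) ≠ 0`** (`Λ_2` itself lies in it:
`Λ_2 ∈ G(Λ_2)`, `Λ_1Λ_2 = Λ_1`). [cite: HertlingLarabi2026, §8 Thm. 8.2 (b), chunk p0021] -/
theorem natCard_kerLat_ne_zero {Λ₁ Λ₂ : Submodule ℤ A} (hΛ₁ : IsFullLattice A Λ₁) (h1 : (1 : A) ∈ Λ₁)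
    (hΛ₁Λ₁ : Λ₁ * Λ₁ ≤ Λ₁) (hΛ₂ : IsFullLattice A Λ₂) (h2 : (1 : A) ∈ Λ₂) (hΛ₂Λ₂ : Λ₂ * Λ₂ ≤ Λ₂)
    (hle : Λ₂ ≤ Λ₁) :
    Nat.card {K : Submodule ℤ A //
        (IsFullLattice A K ∧ K / K = Λ₂ ∧ K * ((K / K) / K) = K / K) ∧ Λ₁ * K = Λ₁} ≠ 0 := by
  haveI := finite_kerLat hΛ₁ h1 hΛ₁Λ₁ hΛ₂ h2 hle
  have hO : Λ₂ / Λ₂ = Λ₂ := div_self_eq_of_one_mem h2 hΛ₂Λ₂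
  haveI : Nonempty {K : Submodule ℤ A //
      (IsFullLattice A K ∧ K / K = Λ₂ ∧ K * ((K / K) / K) = K / K) ∧ Λ₁ * K = Λ₁} :=
    ⟨⟨Λ₂, ⟨hΛ₂, hO, by rw [hO, hO, mul_self_eq_of_one_mem h2 hΛ₂Λ₂]⟩, order_mul_order_eq_of_le hΛ₁Λ₁ h2 hle⟩⟩
  exact Nat.card_pos.ne'

/-- **THEOREM 8.2 (f) ∕ 5.12 (e): «The group `Λ_2^{unit}` has finite index in the group `Λ_1^{unit}`»** —
`[Λ_1^{unit} : Λ_2^{unit}] ≠ 0` as a `Nat.card` (and the index set is finite), for orders `Λ_2 ⊆ Λ_1` of every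
finite-dimensional commutative `ℚ`-algebra (from §1: the finite nonempty lattice kernel has
`#ker_ε · [Λ_1^{unit} : Λ_2^{unit}]` elements). [cite: HertlingLarabi2026, §8 Thm. 8.2 (f), chunk p0021]
[cite: HertlingLarabi2026b, §5 Thm. 5.12 (e), chunk p0011] -/
theorem natCard_unitsIndex_ne_zero {Λ₁ Λ₂ : Submodule ℤ A} (hΛ₁ : IsFullLattice A Λ₁) (h1 : (1 : A) ∈ Λ₁)
    (hΛ₁Λ₁ : Λ₁ * Λ₁ ≤ Λ₁) (hΛ₂ : IsFullLattice A Λ₂) (h2 : (1 : A) ∈ Λ₂) (hΛ₂Λ₂ : Λ₂ * Λ₂ ≤ Λ₂)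
    (hle : Λ₂ ≤ Λ₁) :
    Nat.card (Quot fun u v : {u : Aˣ // (u : A) ∈ Λ₁ ∧ ((u⁻¹ : Aˣ) : A) ∈ Λ₁} =>
        ∃ w : Aˣ, (w : A) ∈ Λ₂ ∧ ((w⁻¹ : Aˣ) : A) ∈ Λ₂ ∧ (v.1 : Aˣ) = u.1 * w) ≠ 0 ∧
      Finite (Quot fun u v : {u : Aˣ // (u : A) ∈ Λ₁ ∧ ((u⁻¹ : Aˣ) : A) ∈ Λ₁} =>
        ∃ w : Aˣ, (w : A) ∈ Λ₂ ∧ ((w⁻¹ : Aˣ) : A) ∈ Λ₂ ∧ (v.1 : Aˣ) = u.1 * w) := by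
  have h := natCard_kerLat_ne_zero hΛ₁ h1 hΛ₁Λ₁ hΛ₂ h2 hΛ₂Λ₂ hle
  rw [natCard_kerLat_eq_natCard_ker_mul_index (Λ₂ := Λ₂) h1 hΛ₁Λ₁] at h
  exact ⟨right_ne_zero_of_mul h, Nat.finite_of_card_ne_zero (right_ne_zero_of_mul h)⟩

omit [Algebra ℚ A] in
/-- **THEOREM 5.12 (e): «The groups `(Λ_1/C)^{unit}` and `(Λ_2/C)^{unit}` are finite»** — for any `Λ ⊆ Λ_1`,
the classes modulo `C = Λ_2:Λ_1` of the elements of `Λ` invertible modulo `C` form a finite set, as soon as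
`nΛ_1 ⊆ C` for some `n ≠ 0` (true for the conductor of orders, `C` being a full lattice) — they embed into the
finite quotient `Λ_1/C` (Thm. 7.6 (a)). [cite: HertlingLarabi2026b, §5 Thm. 5.12 (e), chunk p0011]
[cite: HertlingLarabi2026, §7 Thm. 7.6 (a) («The quotient `Λ/L` is a finite commutative ring»), chunk p0019] -/
theorem finite_unitsModConductor [IsAddTorsionFree A] {Λ₁ Λ₂ Λ : Submodule ℤ A} (hΛ₁fg : Λ₁.FG)
    (hΛ : Λ ≤ Λ₁) {n : ℤ} (hn : n ≠ 0) (hnC : ∀ x ∈ Λ₁, n • x ∈ Λ₂ / Λ₁) :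
    Finite (Quot fun a b : {a : A // a ∈ Λ ∧ ∃ a' ∈ Λ, a * a' - 1 ∈ Λ₂ / Λ₁} => a.1 - b.1 ∈ Λ₂ / Λ₁) := by
  have hidx := Literature.NumberTheory.Automorphic.relIndex_ne_zero_of_smul_mem Λ₁ hΛ₁fg hn (Λ₂ / Λ₁) hnC
  rw [AddSubgroup.relIndex] at hidx
  haveI := (AddSubgroup.fintypeOfIndexNeZero hidx).finite
  refine Finite.of_injective (β := Λ₁.toAddSubgroup ⧸
      (Λ₂ / Λ₁).toAddSubgroup.addSubgroupOf Λ₁.toAddSubgroup)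
    (Quot.lift (fun a : {a : A // a ∈ Λ ∧ ∃ a' ∈ Λ, a * a' - 1 ∈ Λ₂ / Λ₁} =>
        ((⟨a.1, hΛ a.2.1⟩ : Λ₁.toAddSubgroup) : Λ₁.toAddSubgroup ⧸
          (Λ₂ / Λ₁).toAddSubgroup.addSubgroupOf Λ₁.toAddSubgroup))
      fun a b hab => QuotientAddGroup.eq.2 (by
        rw [AddSubgroup.mem_addSubgroupOf]
        change -a.1 + b.1 ∈ Λ₂ / Λ₁
        rw [neg_add_eq_sub, ← neg_sub]
        exact (Λ₂ / Λ₁).neg_mem hab)) ?_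
  rintro ⟨a⟩ ⟨b⟩ hab
  have h := QuotientAddGroup.eq.1 hab
  rw [AddSubgroup.mem_addSubgroupOf] at h
  change -a.1 + b.1 ∈ Λ₂ / Λ₁ at h
  refine Quot.sound ?_
  rw [← neg_sub, ← neg_add_eq_sub]
  exact (Λ₂ / Λ₁).neg_mem h

/-- **THEOREM 5.12 (e) for the conductor of two orders `Λ_2 ⊆ Λ_1` of a finite-dimensional commutative
`ℚ`-algebra: `(Λ_1/C)^{unit}` and `(Λ_2/C)^{unit}` are finite.** [cite: HertlingLarabi2026b, §5 Thm. 5.12 (e), chunk p0011] -/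
theorem finite_unitsModConductor_of_orders {Λ₁ Λ₂ : Submodule ℤ A} (hΛ₁ : IsFullLattice A Λ₁)
    (hΛ₂ : IsFullLattice A Λ₂) (hle : Λ₂ ≤ Λ₁) :
    Finite (Quot fun a b : {a : A // a ∈ Λ₁ ∧ ∃ a' ∈ Λ₁, a * a' - 1 ∈ Λ₂ / Λ₁} => a.1 - b.1 ∈ Λ₂ / Λ₁) ∧
      Finite (Quot fun a b : {a : A // a ∈ Λ₂ ∧ ∃ a' ∈ Λ₂, a * a' - 1 ∈ Λ₂ / Λ₁} =>
        a.1 - b.1 ∈ Λ₂ / Λ₁) := by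
  haveI : IsAddTorsionFree A := IsAddTorsionFree.of_isTorsionFree ℚ A
  obtain ⟨n, hn, hnC⟩ := Literature.NumberTheory.Automorphic.exists_smul_mem_of_fg
    (isFullLattice_div hΛ₂ hΛ₁) hΛ₁.1
  exact ⟨finite_unitsModConductor hΛ₁.1 le_rfl hn hnC, finite_unitsModConductor hΛ₁.1 hle hn hnC⟩

end ClassNumberFormula

end Literature.NumberTheory.ComplexMultiplication.FiniteQAlgebraLattice
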